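import Summits.BirchSwinnertonDyer.BirchSwinnertonDyer.Theorems.ClassRecordThreeEulerHalvesAtThreeEichlerShimuraTorsionCountA
import Summits.BirchSwinnertonDyer.BirchSwinnertonDyer.Theorems.ClassRecordThreeEulerHalvesAtThreeEichlerShimuraLevelCountB
import HarnessLib

/-!
# The torsion-refined Shapiro count for a general finite-index level `Γ ∋ -1` over an arbitrary field `K`, part C: SHAPIRO'S LEMMA over `K`

Helper file (route `ClassRecordThree`, crux `EulerHalvesAtThree`, print residue (SIGᶜ-lift)(ii); seat bsd-idea-10 g24, `--supports
stmt-BirchSwinnertonDyer-19109 --as helper`). The `K`-valued version of `…EichlerShimuraLevelCountB` with the TORSION condition added: the space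
`parTorsCocycles K Γ` of additive `u : Γ → K` killing the parabolic elements and the elements of finite order (= the space `V_p(Γ)` of the lifting engine
`…EichlerShimuraModLift` for `K = 𝔽_p`), the Shapiro lift `E_u(g) = (x ↦ u(s(gx)⁻¹ g s(x))) ∈ K^X` (a cocycle of `SL(2, ℤ)`, restricting to `u`, with
`E_u(-1) = 0` from the torsion condition — in characteristic `2` the real argument `2u(-1) = 0` is void), the parabolic condition (the cusp sums of `E_u(T)`
vanish) and the two TORSION CONDITIONS `E_u(S)(x) = 0` at the `S`-fixed cosets, `E_u(ST)(x) = 0` at the `ST`-fixed cosets (the transfer elements there have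
order `4` resp. dividing `6`), which place `E_u(S) ∈ kerS`, `E_u(ST) ∈ kerST` (part D). Set-theoretic sections and transfer elements are those of
`EichlerShimuraLevel` (`sec`, `liftElem`). No named facts; nothing specific to BSD; no summit statement is proved.

## References
* G. Shimura, *Introduction to the arithmetic theory of automorphic functions* (1971), §8.1 [ShimuraIATAF1971].
* K. S. Brown, *Cohomology of groups* (1982), III.6 [Brown1982].
-/

noncomputable section

open scoped MatrixGroups ModularForm

open CongruenceSubgroup Matrix.SpecialLinearGroup ModularGroup

set_option linter.dupNamespace false

namespace Summit.BirchSwinnertonDyer.BirchSwinnertonDyer.Theorems.EichlerShimuraLevelK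

open _root_.Module _root_.LinearMap
open Literature.NumberTheory.EllipticCurves.ModularForms
open scoped Classical

variable {K : Type*} [Field K]

variable {Γ : Subgroup SL(2, ℤ)}

/-! ### Parabolic–torsion cocycles of a level `Γ` with values in `K` -/

variable (K Γ) in
/-- **The parabolic–torsion cocycles of a level `Γ ≤ SL(2, ℤ)` with values in the field `K`**: maps `u : Γ → K` which are additive and vanish on
every parabolic element (Mathlib's `Matrix.IsParabolic` for the integral matrix) AND on every element of finite order of `Γ` — the group-theoretic
model of `Hom(π₁(X_Γ), K) = H¹(X_Γ, K)` (`π₁(X_Γ) = Γ/⟨⟨torsion, parabolic⟩⟩`); over `ℝ` the torsion condition is automatic and this is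
`EichlerShimuraLevel.parabolicCocycles Γ`; over `𝔽_p` it is the space `V_p(Γ)` of the lifting engine `…EichlerShimuraModLift.modLift_of_basis`.
[cite: ShimuraIATAF1971, §8.1 (8.1.1), (8.1.4)] -/
def parTorsCocycles : Submodule K (Γ → K) where
  carrier := {u | (∀ γ δ : Γ, u (γ * δ) = u γ + u δ) ∧
    (∀ γ : Γ, ((γ : SL(2, ℤ)) : Matrix (Fin 2) (Fin 2) ℤ).IsParabolic → u γ = 0) ∧
    ∀ γ : Γ, IsOfFinOrder γ → u γ = 0}
  add_mem' := by
    rintro u v ⟨hu, hup, hue⟩ ⟨hv, hvp, hve⟩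
    refine ⟨fun γ δ ↦ ?_, fun γ hγ ↦ ?_, fun γ hγ ↦ ?_⟩
    · simp only [Pi.add_apply, hu, hv]
      abel
    · simp [hup γ hγ, hvp γ hγ]
    · simp [hue γ hγ, hve γ hγ]
  zero_mem' := ⟨fun _ _ ↦ by simp, fun _ _ ↦ rfl, fun _ _ ↦ rfl⟩
  smul_mem' := by
    rintro c u ⟨hu, hup, hue⟩
    refine ⟨fun γ δ ↦ ?_, fun γ hγ ↦ ?_, fun γ hγ ↦ ?_⟩
    · simp only [Pi.smul_apply, smul_eq_mul, hu, mul_add]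
    · simp [hup γ hγ]
    · simp [hue γ hγ]

/-- Membership in `parTorsCocycles`. [folklore] -/
theorem mem_parTorsCocycles_iff {u : Γ → K} :
    u ∈ parTorsCocycles K Γ ↔ (∀ γ δ : Γ, u (γ * δ) = u γ + u δ) ∧
      (∀ γ : Γ, ((γ : SL(2, ℤ)) : Matrix (Fin 2) (Fin 2) ℤ).IsParabolic → u γ = 0) ∧
      ∀ γ : Γ, IsOfFinOrder γ → u γ = 0 :=
  Iff.rfl

/-! ### Shapiro's lemma made explicit: cocycles of `SL(2, ℤ)` in `ℝ^X` from homomorphisms of `Γ` -/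

/-- `u(1) = 0` for an additive `u : Γ → K`. [folklore] -/
theorem map_one_of_additive {u : Γ → K} (hu : ∀ γ δ, u (γ * δ) = u γ + u δ) : u 1 = 0 := by
  have h := hu 1 1
  rw [mul_one] at h
  exact left_eq_add.mp h

/-- `u(γ⁻¹) = -u(γ)` for an additive `u : Γ → K`. [folklore] -/
theorem map_inv_of_additive {u : Γ → K} (hu : ∀ γ δ, u (γ * δ) = u γ + u δ) (γ : Γ) :
    u γ⁻¹ = -u γ := by
  have h := hu γ⁻¹ γ
  rw [inv_mul_cancel, map_one_of_additive hu] at h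
  exact eq_neg_of_add_eq_zero_left h.symm

/-- The **Shapiro lift** `E_u(g) = (x ↦ u(s(gx)⁻¹ g s(x))) ∈ K^X` of a function `u : Γ → K`
at `g ∈ SL(2, ℤ)` (the explicit inverse of the Shapiro isomorphism
`H¹(SL(2, ℤ), Coind K) ≅ H¹(Γ, K)` on cocycles). [folklore] -/
def lift (u : Γ → K) (g : SL(2, ℤ)) : (SL(2, ℤ) ⧸ Γ) → K := fun x ↦ u (EichlerShimuraLevel.liftElem g x)

omit [Field K] in
/-- Unfolding `lift`. [folklore] -/
@[simp] theorem lift_apply (u : Γ → K) (g : SL(2, ℤ)) (x : (SL(2, ℤ) ⧸ Γ)) :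
    lift u g x = u (EichlerShimuraLevel.liftElem g x) := rfl

/-- The coboundary `δf(g) = g^* f - f` of `f ∈ K^X`. [folklore] -/
def cobd (f : (SL(2, ℤ) ⧸ Γ) → K) (g : SL(2, ℤ)) : (SL(2, ℤ) ⧸ Γ) → K := coperm K Γ g f - f

/-- Coboundaries are cocycles: `δf(gh) = h^* δf(g) + δf(h)`. [folklore] -/
theorem cobd_mul (f : (SL(2, ℤ) ⧸ Γ) → K) (g h : SL(2, ℤ)) :
    cobd f (g * h) = coperm K Γ h (cobd f g) + cobd f h := by
  simp only [cobd, coperm_mul, LinearMap.comp_apply, map_sub]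
  abel

/-- `δf(1) = 0`. [folklore] -/
theorem cobd_one (f : (SL(2, ℤ) ⧸ Γ) → K) : cobd f 1 = 0 := by
  simp [cobd, coperm_one]

/-- `δf(-1) = 0`. [folklore] -/
theorem cobd_neg_one [Fact ((-1 : SL(2, ℤ)) ∈ Γ)] (f : (SL(2, ℤ) ⧸ Γ) → K) : cobd f (-1) = 0 := by
  simp [cobd, coperm_neg_one]

/-- Coboundaries restrict to zero on `Γ`: `δf(γ)(Γ) = 0`. [folklore] -/
theorem cobd_apply_coe_one (f : (SL(2, ℤ) ⧸ Γ) → K) (γ : Γ) :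
    cobd f γ ((1 : SL(2, ℤ)) : (SL(2, ℤ) ⧸ Γ)) = 0 := by
  simp [cobd, EichlerShimuraLevel.smul_coe_one_of_mem γ.2]

/-- The cocycle `E_u + δf`. [folklore] -/
def tot (u : Γ → K) (f : (SL(2, ℤ) ⧸ Γ) → K) (g : SL(2, ℤ)) : (SL(2, ℤ) ⧸ Γ) → K :=
  lift u g + cobd f g

section Additive

variable {u : Γ → K} (hu : ∀ γ δ, u (γ * δ) = u γ + u δ)
include hu

/-- **The Shapiro lift of a homomorphism is a cocycle**: `E(gh) = h^* E(g) + E(h)`. [folklore] -/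
theorem lift_mul (g h : SL(2, ℤ)) : lift u (g * h) = coperm K Γ h (lift u g) + lift u h := by
  funext x
  simp only [lift_apply, Pi.add_apply, coperm_apply, EichlerShimuraLevel.liftElem_mul, hu]

/-- `E(1) = 0`. [folklore] -/
theorem lift_one : lift u 1 = 0 := by
  funext x
  simp [EichlerShimuraLevel.liftElem_one, map_one_of_additive hu]

/- `E(-1) = 0` when `u` ALSO kills the elements of finite order (`ℓ(-1, x) = -1` has order `2`; over `ℝ` one argues `2u(-1) = u(1) = 0`,
which fails in characteristic `2`). -/
omit hu in
/-- `E(-1) = 0` from the torsion condition. [folklore] -/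
theorem lift_neg_one [Fact ((-1 : SL(2, ℤ)) ∈ Γ)] (htors : ∀ γ : Γ, IsOfFinOrder γ → u γ = 0) : lift u (-1) = 0 := by
  funext x
  simp only [lift_apply, Pi.zero_apply]
  apply htors
  rw [isOfFinOrder_iff_pow_eq_one]
  exact ⟨2, by norm_num, Subtype.ext (by simp [pow_two, EichlerShimuraLevel.neg_one_smul_coset'])⟩

/-- **The lift restricts to `u` on `Γ`**: `E_u(γ)(Γ) = u(s₀⁻¹γs₀) = u(γ)`. [folklore] -/
theorem lift_apply_coe_one (γ : Γ) : lift u γ ((1 : SL(2, ℤ)) : (SL(2, ℤ) ⧸ Γ)) = u γ := by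
  have h1 : EichlerShimuraLevel.liftElem (γ : SL(2, ℤ)) ((1 : SL(2, ℤ)) : (SL(2, ℤ) ⧸ Γ)) =
      (⟨EichlerShimuraLevel.sec ((1 : SL(2, ℤ)) : (SL(2, ℤ) ⧸ Γ)), EichlerShimuraLevel.sec_one_mem⟩ : Γ)⁻¹ * γ *
        ⟨EichlerShimuraLevel.sec ((1 : SL(2, ℤ)) : (SL(2, ℤ) ⧸ Γ)), EichlerShimuraLevel.sec_one_mem⟩ :=
    Subtype.ext (by simp [EichlerShimuraLevel.smul_coe_one_of_mem γ.2])
  rw [lift_apply, h1, hu, hu, map_inv_of_additive hu]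
  ring

/-- `(E_u + δf)(gh) = h^*(E_u + δf)(g) + (E_u + δf)(h)`. [folklore] -/
theorem tot_mul (f : (SL(2, ℤ) ⧸ Γ) → K) (g h : SL(2, ℤ)) :
    tot u f (g * h) = coperm K Γ h (tot u f g) + tot u f h := by
  simp only [tot, lift_mul hu, cobd_mul, map_add]
  abel

/-- `(E_u + δf)(1) = 0`. [folklore] -/
theorem tot_one (f : (SL(2, ℤ) ⧸ Γ) → K) : tot u f 1 = 0 := by
  simp [tot, lift_one hu, cobd_one]

omit hu in
/-- `(E_u + δf)(-1) = 0`. [folklore] -/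
theorem tot_neg_one [Fact ((-1 : SL(2, ℤ)) ∈ Γ)] (htors : ∀ γ : Γ, IsOfFinOrder γ → u γ = 0) (f : (SL(2, ℤ) ⧸ Γ) → K) :
    tot u f (-1) = 0 := by
  simp [tot, lift_neg_one htors, cobd_neg_one]

/-- `(E_u + δf)(g⁻¹) = -(g⁻¹)^*(E_u + δf)(g)`. [folklore] -/
theorem tot_inv (f : (SL(2, ℤ) ⧸ Γ) → K) (g : SL(2, ℤ)) :
    tot u f g⁻¹ = -coperm K Γ g⁻¹ (tot u f g) := by
  have h := tot_mul hu f g g⁻¹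
  rw [mul_inv_cancel, tot_one hu] at h
  exact eq_neg_of_add_eq_zero_right h.symm

/-- `(E_u + δf)(γ)(Γ) = u(γ)` for `γ ∈ Γ`. [folklore] -/
theorem tot_apply_coe_one (f : (SL(2, ℤ) ⧸ Γ) → K) (γ : Γ) :
    tot u f γ ((1 : SL(2, ℤ)) : (SL(2, ℤ) ⧸ Γ)) = u γ := by
  simp only [tot, Pi.add_apply, lift_apply_coe_one hu, cobd_apply_coe_one, add_zero]

/-- **A cocycle of `SL(2, ℤ) = ⟨S, T⟩` vanishing at `S` and `T` vanishes.** [folklore] -/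
theorem tot_eq_zero_of_S_T (f : (SL(2, ℤ) ⧸ Γ) → K) (hS : tot u f S = 0) (hT : tot u f T = 0)
    (g : SL(2, ℤ)) : tot u f g = 0 := by
  have hg : g ∈ Subgroup.closure ({S, T} : Set SL(2, ℤ)) := by
    rw [SpecialLinearGroup.SL2Z_generators]
    exact Subgroup.mem_top g
  induction hg using Subgroup.closure_induction with
  | mem x hx =>
    rcases hx with rfl | rfl
    · exact hS
    · exact hT
  | one => exact tot_one hu f
  | mul x y _ _ hx hy => rw [tot_mul hu, hx, hy, map_zero, add_zero]
  | inv x _ hx => rw [tot_inv hu, hx, map_zero, neg_zero]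

/-- `E_u(Tⁿ)(x) = ∑_{i<n} E_u(T)(Tⁱx)`. [folklore] -/
theorem lift_T_pow_apply (n : ℕ) (x : (SL(2, ℤ) ⧸ Γ)) :
    lift u (T ^ n) x = ∑ i ∈ Finset.range n, lift u T (T ^ i • x) := by
  induction n generalizing x with
  | zero => rw [pow_zero, lift_one hu]; simp
  | succ n ih =>
    rw [pow_succ, lift_mul hu, Pi.add_apply, coperm_apply, ih, Finset.sum_range_succ', pow_zero,
      one_smul]
    simp_rw [smul_smul, ← pow_succ]

end Additive

/-! ### The parabolic condition: cusp sums of `E_u(T)` vanish -/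

/-- **`E_u(T^w)(x) = u(s(x)⁻¹ T^w s(x)) = 0` for a parabolic cocycle `u` when `T^w x = x`,
`w ≠ 0`** (`s(x)⁻¹T^ws(x)` is parabolic). [folklore] -/
theorem lift_T_pow_apply_eq_zero (u : parTorsCocycles K Γ) {w : ℕ} (hw : w ≠ 0)
    {x : (SL(2, ℤ) ⧸ Γ)} (hx : T ^ w • x = x) : lift (u : Γ → K) (T ^ w) x = 0 := by
  rw [lift_apply]
  apply (mem_parTorsCocycles_iff.mp u.2).2.1
  rw [EichlerShimuraLevel.coe_liftElem, hx]
  exact ParabolicCount.isParabolic_conj (ParabolicCount.isParabolic_T_pow hw) (EichlerShimuraLevel.sec x)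

/-- **The cusp sums of `E_u(T)` vanish** for a parabolic cocycle `u` (finite-index `Γ`): over the
orbit of a base point `x` of width `w`, `∑_{i<w} E_u(T)(Tⁱx) = E_u(T^w)(x) = 0`. [folklore] -/
theorem cuspSum_lift_T [Γ.FiniteIndex] (u : parTorsCocycles K Γ) :
    cuspSum K Γ (lift (u : Γ → K) T) = 0 := by
  funext p
  obtain ⟨p, hp⟩ := p
  rw [cuspSum_apply, Pi.zero_apply, Level.sum_orbitFin_eq,
    ← lift_T_pow_apply (mem_parTorsCocycles_iff.mp u.2).1 (Level.width Γ p) p]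
  exact lift_T_pow_apply_eq_zero u (Level.width_pos Γ p).ne' (Level.T_pow_width_smul Γ p)


/-! ### The torsion conditions: `E_u(S)` vanishes at the `S`-fixed cosets, `E_u(ST)` at the `ST`-fixed cosets -/

/-- **`E_u(S)(x) = u(s(x)⁻¹ S s(x)) = 0` at an `S`-fixed coset** for a parabolic–torsion cocycle `u` (`(s(x)⁻¹Ss(x))⁴ = 1`). [folklore] -/
theorem lift_S_apply_eq_zero (u : parTorsCocycles K Γ) {x : (SL(2, ℤ) ⧸ Γ)} (hx : S • x = x) :
    lift (u : Γ → K) S x = 0 := by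
  rw [lift_apply]
  apply (mem_parTorsCocycles_iff.mp u.2).2.2
  rw [isOfFinOrder_iff_pow_eq_one]
  refine ⟨4, by norm_num, Subtype.ext ?_⟩
  rw [Subgroup.coe_pow, EichlerShimuraLevel.coe_liftElem, hx, Subgroup.coe_one, show (4 : ℕ) = 2 * 2 from rfl, pow_mul]
  have h2 : ((EichlerShimuraLevel.sec x)⁻¹ * S * EichlerShimuraLevel.sec x) ^ 2 =
      (EichlerShimuraLevel.sec x)⁻¹ * (S * S) * EichlerShimuraLevel.sec x := by
    rw [pow_two]
    group
  rw [h2, S_mul_S_eq_neg_one, pow_two]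
  simp

/-- **`E_u(ST)(x) = u(s(x)⁻¹ ST s(x)) = 0` at an `ST`-fixed coset** for a parabolic–torsion cocycle `u` (`(s(x)⁻¹STs(x))⁶ = 1`). [folklore] -/
theorem lift_ST_apply_eq_zero (u : parTorsCocycles K Γ) {x : (SL(2, ℤ) ⧸ Γ)} (hx : (S * T) • x = x) :
    lift (u : Γ → K) (S * T) x = 0 := by
  rw [lift_apply]
  apply (mem_parTorsCocycles_iff.mp u.2).2.2
  rw [isOfFinOrder_iff_pow_eq_one]
  refine ⟨6, by norm_num, Subtype.ext ?_⟩
  rw [Subgroup.coe_pow, EichlerShimuraLevel.coe_liftElem, hx, Subgroup.coe_one, show (6 : ℕ) = 3 * 2 from rfl, pow_mul]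
  have h3 : ((EichlerShimuraLevel.sec x)⁻¹ * (S * T) * EichlerShimuraLevel.sec x) ^ 3 =
      (EichlerShimuraLevel.sec x)⁻¹ * (S * T * (S * T) * (S * T)) * EichlerShimuraLevel.sec x := by
    rw [pow_succ, pow_two]
    group
  rw [h3, ParabolicCount.ST_pow_three_eq, pow_two]
  simp

/-- **`u(-1) = 0`** for a parabolic–torsion cocycle (`-1` has order `2`). [folklore] -/
theorem map_neg_one_eq_zero (u : parTorsCocycles K Γ) (hneg : (-1 : SL(2, ℤ)) ∈ Γ) : (u : Γ → K) ⟨-1, hneg⟩ = 0 := by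
  apply (mem_parTorsCocycles_iff.mp u.2).2.2
  rw [isOfFinOrder_iff_pow_eq_one]
  exact ⟨2, by norm_num, Subtype.ext (by simp [pow_two])⟩

end Summit.BirchSwinnertonDyer.BirchSwinnertonDyer.Theorems.EichlerShimuraLevelK

end
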